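import Summits.QuantumFields.YangMills.Theorems.BalabanUVNodesN18TransportedPairGcValued
import Summits.QuantumFields.YangMills.Theorems.UnitScaleTiltProp8ChartCovariance
import Literature.MathematicalPhysics.QuantumFieldTheory.Balaban1983to89.B12RegularSpaces111Gauge
import Literature.MathematicalPhysics.QuantumFieldTheory.Balaban1983to89.B12Membership314
import HarnessLib

/-!
# BalabanUVNodes ∕ node N18 = NE5 — closure-ledger item (iii): THE (0.4) LOOP VARIABLES OF THE `G`-VALUED FACTOR ARE SMALL IN THE INTERIOR, FROM THE (1.12)
# LOCAL GAUGE — `‖U(loop) − 1‖ ≤ 8ℓ·ξ·cB·α₀` whenever the two blocks of the coarse bond lie in one (1.12) cube (gauge covariance of the loops + unitary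
# conjugation + UST's first-order loop letter) (Track A, DAG node N18 = `T4OutputRate.NE5` :211; cluster K4 «SpineRates», item K3⁷ `SpineGivenEndpointR13SepCoPH`;
# seat pub-ymgap-dag-n18-w3 g3)

HONEST FRAMING.  Count-neutral kernel bookkeeping (`--supports stmt-QuantumFields-20544 --as helper`): the loops of (0.4) are gauge-COVARIANT (UST
`Prop8Chart.loopHolU_gaugeActT`), conjugation by a `G`-valued (norm `≤ 1`) unit preserves `‖· − 1‖` (`B12RegularSpaces111Gauge.norm_conj_sub_one_eq`), and in the
(1.12) gauge the field is `exp iξA` with `|A| < cB·α₀` — bondwise near `1` — so UST's `Prop8Chart.norm_loopHolU_sub_one_le` applies.  This is ONE input of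
`…N18TransportedPairGcValued` §4 (`avgUnits_mem_suModel_Gc_of_factors`: the loops of the factor within `r` of `1`), now PRODUCED from condition (i) = (1.11)–(1.12)
of the pair — in the INTERIOR: for coarse bonds whose two blocks lie in ONE (1.12) cube of the frame.  LOCATED (bus [DAGN18W3-G3-LOCATED-1]): coarse bonds crossing a
face of the cube partition, and the plaquette letter, need a lattice Stokes INSIDE the two-block box; the tree's budget-Stokes `LatticeWordStokesLocal.dist1_holAt_le_local`
∕ `BlockAveragingPlaquetteBoundLocal.dist1_loopHol_le_local` asks plaquettes based in THREE blocks `B(c₋ − e_μ), B(c₋), B(c₊)` (and sticking out by one site), which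
the run-B frame on the paired domain of the SAME physical extent (`pairOfRecord`) does not control at `∂Y`.  Nothing of Bałaban's RG asserted; NE5 NOT PRINTED ∕ NOT
proved; N18 NOT discharged; nothing about the continuum ∕ OS ∕ mass gap ∕ Clay.

WHAT.
* §1 `norm_coe_expI_sub_one_le` (`‖exp iξa − 1‖ ≤ 2ξ‖a‖` for `ξ‖a‖ ≤ 1`), `norm_loopVarU_gaugeU_sub_one_eq` (the loops' `‖· − 1‖` is invariant under `G`-valued gauges).
* §2 ★ `norm_loopVarU_sub_one_le_of_localGauge` — if `U^u = exp iξA` with `‖A‖ ≤ r` on the two-block bonds of `c` (`u` `G`-valued, `ξr ≤ 1`, `8ℓξr ≤ 1`), then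
  `‖U(loop_i(c)) − 1‖ ≤ 8ℓ·ξ·r` for every (0.4) loop at `c`.
* §3 ★★ `norm_loopVarU_sub_one_le_of_condI` — from `CondI 𝓜 F c₀ α₀ U` and a cube `C ∈ F.cubes` whose bonds contain the two-block bonds of `c`:
  `‖U(loop_i(c)) − 1‖ ≤ 8ℓ·ξ·cB·α₀` (`8ℓ·ξ·cB·α₀ ≤ 1`, `0 ≤ cB·α₀`; `G` with `‖·‖ ≤ 1`).

0 `def`, 0 `sorry`.  References: T. Bałaban, CMP **109** (1987) 249–301 [Balaban1987RG1] ((0.4) p.253, (1.11)–(1.12) p.262); CMP **98** (1985) 17–51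
[Balaban1985Averaging] ((8)–(11) pp.18–19, (122)–(123) p.36).
-/

noncomputable section

open scoped BigOperators Matrix.Norms.L2Operator

namespace YMDAG.N18.TransportOfRecord

open Complex (I)
open Literature.MathematicalPhysics.QuantumFieldTheory.Balaban1983to89
open Literature.MathematicalPhysics.QuantumFieldTheory.Balaban1983to89.T4Continuum
open Literature.MathematicalPhysics.QuantumFieldTheory.Balaban1983to89.BlockAveraging
open Literature.MathematicalPhysics.QuantumFieldTheory.Balaban1983to89.B12RegularSpaces111
open Literature.MathematicalPhysics.QuantumFieldTheory.Balaban1983to89.B12RegularSpaces111Gauge (norm_conj_sub_one_eq)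
open Literature.MathematicalPhysics.QuantumFieldTheory.Balaban1983to89.B12Membership314 (norm_I_mul_smul)
open Literature.MathematicalPhysics.QuantumFieldTheory.Balaban1983to89.Node00.W1
open Summit.QuantumFields.YangMills.Theorems.Prop8Chart (loopHolU loopHolU_gaugeActT norm_loopHolU_sub_one_le)

section Loops

variable {P : Params} {j : ℕ} {𝔸 : Type*} [NormedRing 𝔸] [NormedAlgebra ℂ 𝔸] [CompleteSpace 𝔸]

/-! ## §1 Two letters: the chart factor near `1`, the loops' `‖· − 1‖` is gauge invariant -/

/-- `‖exp iξa − 1‖ ≤ 2ξ‖a‖` for `0 ≤ ξ`, `ξ‖a‖ ≤ 1` (`B7TransferAnalyticMean.norm_exp_sub_one_le_two_mul`). [cite: Balaban1987RG1, (1.12)-(1.13) p.262] -/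
theorem norm_coe_expI_sub_one_le {ξ : ℝ} (hξ : 0 ≤ ξ) {a : 𝔸} (h : ξ * ‖a‖ ≤ 1) :
    ‖((expI ξ a : 𝔸ˣ) : 𝔸) - 1‖ ≤ 2 * (ξ * ‖a‖) := by
  have hn : ‖(I * (ξ : ℂ)) • a‖ = ξ * ‖a‖ := norm_I_mul_smul hξ a
  have h1 : ‖(I * (ξ : ℂ)) • a‖ ≤ 1 := hn ▸ h
  have := B7TransferAnalyticMean.norm_exp_sub_one_le_two_mul h1
  rw [hn] at this
  exact this

variable [NormOneClass 𝔸]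

omit [NormedAlgebra ℂ 𝔸] [CompleteSpace 𝔸] [NormOneClass 𝔸] in
/-- **THE LOOPS' DISTANCE FROM `1` IS GAUGE INVARIANT** for `G`-valued gauges (`‖·‖ ≤ 1` on `G`): `‖U^u(loop) − 1‖ = ‖u(y)U(loop)u(y)⁻¹ − 1‖ = ‖U(loop) − 1‖`
(UST `loopHolU_gaugeActT` + `norm_conj_sub_one_eq`). [cite: Balaban1985Averaging, (8)-(11) pp.18-19] -/
theorem norm_loopVarU_gaugeU_sub_one_eq {G : Subgroup 𝔸ˣ} (hG1 : ∀ g ∈ G, ‖(g : 𝔸)‖ ≤ 1) {u : Site P j → 𝔸ˣ} (hu : ∀ x, u x ∈ G)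
    (U : GaugeField P j 𝔸ˣ) (c : PBond P (j + 1)) (i : Idx P) :
    ‖((loopVarU (gaugeU u U) c i : 𝔸ˣ) : 𝔸) - 1‖ = ‖((loopVarU U c i : 𝔸ˣ) : 𝔸) - 1‖ := by
  have h : loopVarU (gaugeU u U) c i = u (emb c.src) * loopVarU U c i * (u (emb c.src))⁻¹ := loopHolU_gaugeActT u U c i
  rw [h, Units.val_mul, Units.val_mul, norm_conj_sub_one_eq hG1 (hu _)]

/-! ## §2 ★ The loops of `U` from the (1.12) gauge on the two blocks -/

/-- ★ **THE (0.4) LOOPS OF `U` ARE SMALL WHEN `U` IS `exp iξA` IN SOME `G`-VALUED GAUGE ON THE TWO BLOCKS**: if `U^u(b) = exp iξA(b)` with `‖A(b)‖ ≤ r` for every fine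
bond `b` with both ends in the blocks `B(c₋) ∪ B(c₊)`, `u` `G`-valued (`‖·‖ ≤ 1` on `G`), `0 ≤ ξ`, `ξr ≤ 1` and `8ℓξr ≤ 1` (`ℓ = (d+2)L`), then
`‖U(loop_i(c)) − 1‖ ≤ 8ℓ·ξ·r` for every (0.4) loop index `i` — gauge invariance (§1) + UST's first-order loop letter for the bondwise-near-`1` field `U^u`.
[cite: Balaban1987RG1, (0.4) p.253, (1.12) p.262; Balaban1985Averaging, (122)-(123) p.36] -/
theorem norm_loopVarU_sub_one_le_of_localGauge {G : Subgroup 𝔸ˣ} (hG1 : ∀ g ∈ G, ‖(g : 𝔸)‖ ≤ 1) (hj : j + 1 ≤ P.m + P.K)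
    {U : GaugeField P j 𝔸ˣ} {u : Site P j → 𝔸ˣ} (hu : ∀ x, u x ∈ G) {A : PBond P j → 𝔸} {ξ r : ℝ} (hξ : 0 ≤ ξ) (hr : 0 ≤ r) (hξr : ξ * r ≤ 1)
    (c : PBond P (j + 1)) (hℓ : 8 * (((P.d + 2) * P.L : ℕ) : ℝ) * (ξ * r) ≤ 1)
    (hgauge : ∀ b : PBond P j, (blockOf b.src = c.src ∨ blockOf b.src = c.tgt) → (blockOf b.tgt = c.src ∨ blockOf b.tgt = c.tgt) →
      gaugeU u U b = expI ξ (A b))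
    (hA : ∀ b : PBond P j, (blockOf b.src = c.src ∨ blockOf b.src = c.tgt) → (blockOf b.tgt = c.src ∨ blockOf b.tgt = c.tgt) → ‖A b‖ ≤ r)
    (i : Idx P) :
    ‖((loopVarU U c i : 𝔸ˣ) : 𝔸) - 1‖ ≤ 8 * (((P.d + 2) * P.L : ℕ) : ℝ) * (ξ * r) := by
  rw [← norm_loopVarU_gaugeU_sub_one_eq hG1 hu U c i]
  have hS : ∀ b : PBond P j, (blockOf b.src = c.src ∨ blockOf b.src = c.tgt) → (blockOf b.tgt = c.src ∨ blockOf b.tgt = c.tgt) →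
      ‖((gaugeU u U b : 𝔸ˣ) : 𝔸) - 1‖ ≤ 2 * (ξ * r) := fun b h1 h2 => by
    rw [hgauge b h1 h2]
    have hb : ξ * ‖A b‖ ≤ ξ * r := mul_le_mul_of_nonneg_left (hA b h1 h2) hξ
    exact (norm_coe_expI_sub_one_le hξ (hb.trans hξr)).trans (by linarith)
  have h := (norm_loopHolU_sub_one_le hj c (s := 2 * (ξ * r)) (by positivity) (by linarith) hS i).1
  calc ‖((loopVarU (gaugeU u U) c i : 𝔸ˣ) : 𝔸) - 1‖ ≤ 4 * (((P.d + 2) * P.L : ℕ) : ℝ) * (2 * (ξ * r)) := h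
    _ = 8 * (((P.d + 2) * P.L : ℕ) : ℝ) * (ξ * r) := by ring

/-! ## §3 ★★ From condition (i): the loops of the factor in the interior of a (1.12) cube -/

/-- ★★ **THE LOOPS OF THE FACTOR FROM CONDITION (i), INTERIOR CASE**: if `U` satisfies (i) = (1.11)–(1.12) on a frame `F` with constants `c₀ = (j, ξ, L, cB)` and
radius `α₀` (`G` with `‖·‖ ≤ 1`, e.g. `SU(N)`), and the two blocks of the coarse bond `c` lie in ONE (1.12) cube `C ∈ F.cubes` (every fine bond with both ends in
`B(c₋) ∪ B(c₊)` is a bond of `C`), then `‖U(loop_i(c)) − 1‖ ≤ 8ℓ·ξ·(cB·α₀)` for every (0.4) loop at `c` (`0 ≤ ξ`, `0 ≤ cB·α₀`, `ξ·cB·α₀ ≤ 1`, `8ℓ·ξ·cB·α₀ ≤ 1`)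
— the input `hr` of `avgUnits_mem_suModel_Gc_of_factors` at `r := 8ℓ·ξ·cB·α₀`.  Coarse bonds whose blocks straddle a cube face are NOT covered (located: box-Stokes
needed). [cite: Balaban1987RG1, (1.11)-(1.12) p.262, (0.4) p.253] -/
theorem norm_loopVarU_sub_one_le_of_condI {𝓜 : Model 𝔸} (hG1 : ∀ g ∈ 𝓜.G, ‖(g : 𝔸)‖ ≤ 1) (hj : j + 1 ≤ P.m + P.K)
    {F : Frame P j 𝔸} {c₀ : StepConsts} {α₀ : ℝ} {U : PBond P j → 𝔸ˣ} (hI : CondI 𝓜 F c₀ α₀ U) (hξ : 0 ≤ c₀.ξ) (hα : 0 ≤ c₀.cB * α₀)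
    (hξα : c₀.ξ * (c₀.cB * α₀) ≤ 1) (c : PBond P (j + 1)) (hℓ : 8 * (((P.d + 2) * P.L : ℕ) : ℝ) * (c₀.ξ * (c₀.cB * α₀)) ≤ 1)
    {C : Region P j} (hC : C ∈ F.cubes)
    (h2b : ∀ b : PBond P j, (blockOf b.src = c.src ∨ blockOf b.src = c.tgt) → (blockOf b.tgt = c.src ∨ blockOf b.tgt = c.tgt) → b ∈ C.bonds)
    (i : Idx P) :
    ‖((loopVarU U c i : 𝔸ˣ) : 𝔸) - 1‖ ≤ 8 * (((P.d + 2) * P.L : ℕ) : ℝ) * (c₀.ξ * (c₀.cB * α₀)) := by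
  obtain ⟨u, hu, A, hgauge, hA, -⟩ := hI.localGauge C hC
  exact norm_loopVarU_sub_one_le_of_localGauge hG1 hj hu hξ hα hξα c hℓ (fun b h1 h2 => hgauge b (h2b b h1 h2))
    (fun b h1 h2 => (hA b (h2b b h1 h2)).le) i

end Loops

end YMDAG.N18.TransportOfRecord

end
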